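import Literature.AnabelianGeometry.AbsoluteAnabelian.AbsCuspFactsCuspidalizationTransport
import HarnessLib

/-!
# [AbsCusp] Thm. 1.1 (iii) (`AbsCusp.Thm_1_1_iii`, FACT-LIST F-0051): INSTANCE FORM at the point extension

S. Mochizuki, *Absolute anabelian cuspidalizations of proper hyperbolic curves*, J. Math. Kyoto Univ. **47**
(2007), Thm. 1.1 (iii) p. 27 of the held copy (`paper:doi-10-1215-kjm-1250281022`): for `α : Π_X ⥲ Π_Y`
"there is a commutative diagram `Π^{c-ab}_{U_{X×X}} ⥲ Π^{c-ab}_{U_{Y×Y}}` over `α × α : Π_{X×X} ⥲ Π_{Y×Y}` …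
compatible with the natural inclusions `D_X ↪ Π^{c-ab}_{U_{X×X}}`, `D_Y ↪ Π^{c-ab}_{U_{Y×Y}}`".  Cell abc-iut,
block F, seat abc-iut-f-053 (gen 4), KEY row INST59H3.  PROOF-ONLY companion of `AbsCuspFacts.lean`
(abc-iut-L4-t16; imported via the tree's `AbsCuspFactsCuspidalizationTransport`, never edited).

THE ROW.  `Thm_1_1_iii DX DY diagX diagY` is a PREDICATE on cuspidalization data `DX : Π_{U_{X×X}} ↠ Π_{X×X}`,
`DY` (the INTERFACE `CuspidalizationData` over the fibre products `squareGroup E = Π_X ×_{G} Π_X`) and subgroups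
`diagX`, `diagY` of the maximal cuspidally abelian quotients.  abc-iut-F-lit's kernel census
(`plan/LF-KERNEL-STATUS.tsv` col. 14) holds the closure refuter `not_forall_thm_1_1_iii` (abc-iut-f-055:
`diagX = ⊥`, `diagY = ⊤` over junk data) and the CONDITIONAL closers `thm_1_1_iii_of_lift`,
`thm_1_1_iii_of_injective_of_diagonal` — no theorem with conclusion HEAD the row at named
data.  This file supplies one, over EVERY profinite group `G`:

* `AbsCusp.thm_1_1_iii_pointExtension G` — at the POINT EXTENSION `Π_X := G ↠ G` (identity augmentation,
  `Δ_X = 1`: "`X` is its base point"), with `Y := X`, the cuspidalization datum `Π_{U_{X×X}} := G` mapping by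
  the DIAGONAL onto `Π_{X×X} = G ×_G G = {(g, g)}` (a continuous bijection: nothing is removed, no cuspidal
  part), and `D_X = D_Y := ⊤ =` the whole (= diagonal) decomposition group: `Thm_1_1_iii` HOLDS — for EVERY
  compatible pair `(α, α_G)` of automorphisms (here `α = α_G` ranges over all of `Aut(G)`), `α × α` lifts along
  the bijective projections and preserves the diagonal (the tree's `thm_1_1_iii_of_injective_of_diagonal`).

HONEST LABEL: DEGENERATE (`Δ = 1`; no proper hyperbolic curve has trivial geometric fundamental group; no
cusps are removed) — a consistency instance of OUR typing exercising the inner `∀ (α, α_G)` over an arbitrary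
profinite automorphism group; the printed Thm. 1.1 (iii) (reconstruction of `Π^{c-ab}_{U_{X×X}}` from `Π_X`
alone) is untouched and has no (M)-form in the tree.  Refuted-as-schema ≠ refuted-in-print; typed ≠ proved;
nothing here bears on the disputed [IUTchIII] Cor. 3.12; no side taken.
-/

noncomputable section

open scoped Classical Pointwise

namespace Literature.AnabelianGeometry.AbsoluteAnabelian

namespace AbsCusp

universe u

/-- The diagonal `g ↦ (g, g)` of a profinite group `G` into the fibre product `G ×_G G` of the point extension
`G ↠ G` (identity augmentation), as a continuous homomorphism; it is the cuspidalization map of the instance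
below. [cite: MochizukiAbsCusp2007, §1 p.6] -/
theorem continuous_diag_codRestrict (G : ProfiniteGrp.{u}) :
    Continuous ((((MonoidHom.id G).prod (MonoidHom.id G)).codRestrict
      (squareGroup ({ arith := G, gal := G, aug := ContinuousMonoidHom.id G,
                      aug_surjective := Function.surjective_id } : FundamentalExtension.{u}))
      fun _ => rfl) : G → squareGroup ({ arith := G, gal := G, aug := ContinuousMonoidHom.id G,
                                          aug_surjective := Function.surjective_id } : FundamentalExtension.{u})) :=
  (continuous_id.prodMk continuous_id).subtype_mk _

/-- **F-0051, INSTANCE FORM at the point extension over every profinite `G`** (`Π_X := G ↠ G`, `Δ_X = 1`,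
`Y := X`; cuspidalization datum `Π_{U_{X×X}} := G` mapping by the diagonal onto `Π_{X×X} = {(g, g)}`;
`D_X = D_Y := ⊤`): `Thm_1_1_iii` holds — every compatible `(α, α_G)` (`α = α_G ∈ Aut(G)`) lifts along the
bijective projections and preserves the diagonal (`thm_1_1_iii_of_injective_of_diagonal`).  DEGENERATE
(nothing removed, `Δ = 1`); 0 hypotheses; the inner universal quantifier ranges over all of `Aut(G)`.
[cite: MochizukiAbsCusp2007, Thm 1.1 (iii) p.27] -/
theorem thm_1_1_iii_pointExtension (G : ProfiniteGrp.{u}) :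
    Literature.AnabelianGeometry.AbsoluteAnabelian.AbsCusp.Thm_1_1_iii
      (E := { arith := G, gal := G, aug := ContinuousMonoidHom.id G, aug_surjective := Function.surjective_id })
      (F := { arith := G, gal := G, aug := ContinuousMonoidHom.id G, aug_surjective := Function.surjective_id })
      ⟨G, ⟨((MonoidHom.id G).prod (MonoidHom.id G)).codRestrict _ fun _ => rfl, continuous_diag_codRestrict G⟩,
        fun p => ⟨p.1.1, Subtype.ext (Prod.ext rfl p.2)⟩⟩
      ⟨G, ⟨((MonoidHom.id G).prod (MonoidHom.id G)).codRestrict _ fun _ => rfl, continuous_diag_codRestrict G⟩,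
        fun p => ⟨p.1.1, Subtype.ext (Prod.ext rfl p.2)⟩⟩
      ⊤ ⊤ := by
  refine thm_1_1_iii_of_injective_of_diagonal _ _ ?_ ?_ ⊤ ⊤ (fun z => iff_of_true trivial ?_)
    (fun w => iff_of_true trivial ?_)
  · intro a b h
    exact congrArg (fun p : squareGroup _ => (p : G × G).1) h
  · intro a b h
    exact congrArg (fun p : squareGroup _ => (p : G × G).1) h
  · exact (CuspidalizationData.projAb _ z).2
  · exact (CuspidalizationData.projAb _ w).2

end AbsCusp

end Literature.AnabelianGeometry.AbsoluteAnabelian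

end
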